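import Mathlib.LinearAlgebra.Matrix.GeneralLinearGroup.Defs
import Mathlib.LinearAlgebra.Matrix.Block
import Mathlib.LinearAlgebra.Matrix.RowCol
import HarnessLib

/-!
# The last-row chart of `GL_{d+1}` acting on row vectors: section, simply transitive subgroup, trivial cocycle

Topic `LinearAlgebra/Matrix`; namespace `Literature.LinearAlgebra.Matrix`. Pure matrix algebra over
a commutative ring `R` (definitions with bodies and theorems; no named fact). Companion of
`MirabolicOrbit` (which works over a field: `mirabolic`, `P \ GL ≃ Fᶜ⁺¹ ∖ 0`).

`GL_{d+1}(R)` acts on row vectors `x ∈ R^{d+1}` by `x ↦ x ᵥ* g`; the stabiliser of the last basis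
vector `e = e_{last}` is the mirabolic subgroup (last row `= e`). On the open "chart"
`{x | x_{last} ∈ Rˣ}` everything is explicit:

* `lastRowSection x` — the identity matrix with its last row replaced by `x` (a **section** of
  `g ↦ e ᵥ* g` over the chart: `lastVec_vecMul_lastRowSection`), `det = x_{last}`
  (`det_lastRowSection`), in `GL` when `x_{last}` is a unit (`lastRowSectionGL`);
* `lastRowGroup R d ≤ GL_{d+1}(R)` — the **last-row group** `H' = {(𝟙 0; y t)}` of matrices equal to
  the identity off the last row; it consists exactly of the sections (`mem_lastRowGroup_iff`), so it
  acts **simply transitively** on the chart, and the section has **trivial cocycle**: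
  `γ(x) h = γ(x ᵥ* h)` for `h ∈ H'` (`lastRowSection_mul_of_mem`);
* `rowStabilizer R d` — the stabiliser of `e` (the mirabolic subgroup over a ring;
  `mem_rowStabilizer_iff`), and the **cocycle** `chartCocycle x p = γ(x) p γ(x ᵥ* p)⁻¹ ∈ rowStabilizer`
  of the section under a general `p` (`chartCocycle_mem_rowStabilizer`), equal to `p` itself at the
  base point for `p` in the stabiliser (`chartCocycle_lastVec`).

These are the coordinates `h = p' γ(x)` (`p'` in the stabiliser, `x = e ᵥ* h` in the chart) of the
induction over the fibration `N_d \ P_{d+1} → N_{d+1} \ GL_{d+1} → P_{d+1} \ GL_{d+1}` used to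
disintegrate invariant Hermitian forms on the Kirillov structure without measure-theoretic
disintegration (the trivial cocycle turns `H'`-invariance into translation invariance on the chart,
whence Haar uniqueness applies fibrewise): Jacquet–Shalika (1981), §3, (3.5) (irreducibility of
`τ_r = Ind_{N_r}^{P_r} θ` by induction over the same tower); Bernstein–Zelevinsky's mirabolic
induction.

## References

* H. Jacquet, J. A. Shalika, *On Euler products and the classification of automorphic
  representations I*, Amer. J. Math. 103 (1981), §3, (3.5) and §4 [JacquetShalikaAJM1981].
* J. W. Cogdell, *Analytic theory of L-functions for GL_n*, in Bernstein–Gelbart (eds.),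
  *An Introduction to the Langlands Program* (2004), §1.1 (`P_n \ GL_n ≃ kⁿ - {0}`)
  [CogdellAnalyticTheory2004].
-/

namespace Literature.LinearAlgebra.Matrix

open _root_.Matrix

variable {R : Type*} [CommRing R] {d : ℕ}

/-! ### The section -/

/-- **The last-row section**: the identity matrix with last row replaced by `x`. [folklore] -/
def lastRowSection (x : Fin (d + 1) → R) : Matrix (Fin (d + 1)) (Fin (d + 1)) R :=
  Matrix.updateRow 1 (Fin.last d) x

/-- The last row of the section is `x`. [folklore] -/
@[simp] theorem lastRowSection_apply_last (x : Fin (d + 1) → R) (j : Fin (d + 1)) :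
    lastRowSection x (Fin.last d) j = x j := by
  simp [lastRowSection]

/-- Off the last row the section is the identity. [folklore] -/
theorem lastRowSection_apply_of_ne (x : Fin (d + 1) → R) {i : Fin (d + 1)} (hi : i ≠ Fin.last d)
    (j : Fin (d + 1)) : lastRowSection x i j = (1 : Matrix (Fin (d + 1)) (Fin (d + 1)) R) i j := by
  simp [lastRowSection, Matrix.updateRow_ne hi]

variable (d R) in
/-- The last basis row vector `e = (0, …, 0, 1)`. [folklore] -/
def lastBasisRow : Fin (d + 1) → R := Pi.single (Fin.last d) 1

/-- The section at the base point is the identity. [folklore] -/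
theorem lastRowSection_lastVec : lastRowSection (lastBasisRow R d) = 1 := by
  ext i j
  by_cases hi : i = Fin.last d
  · subst hi
    rw [lastRowSection_apply_last, lastBasisRow, Matrix.one_apply, Pi.single_apply]
    simp only [eq_comm]
  · rw [lastRowSection_apply_of_ne _ hi]

/-- **`det γ(x) = x_{last}`** (the section is lower triangular with diagonal `1, …, 1, x_{last}`).
[folklore] -/
theorem det_lastRowSection (x : Fin (d + 1) → R) : (lastRowSection x).det = x (Fin.last d) := by
  rw [Matrix.det_of_lowerTriangular (lastRowSection x)]
  · rw [Fintype.prod_eq_single (Fin.last d)]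
    · exact lastRowSection_apply_last x _
    · intro i hi
      rw [lastRowSection_apply_of_ne x hi, Matrix.one_apply_eq]
  · intro i j hij
    have hi : i ≠ Fin.last d := by
      intro h
      subst h
      exact absurd (Fin.le_last j) (not_le.2 hij)
    rw [lastRowSection_apply_of_ne x hi]
    exact Matrix.one_apply_ne (show i ≠ j from fun h => by subst h; exact lt_irrefl _ hij)

/-- `e ᵥ* γ(x) = x`: the section is a section of the last-row map. [folklore] -/
theorem lastVec_vecMul_lastRowSection (x : Fin (d + 1) → R) :
    lastBasisRow R d ᵥ* lastRowSection x = x := by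
  ext j
  rw [lastBasisRow, Matrix.single_one_vecMul]
  exact lastRowSection_apply_last x j

/-- **Trivial cocycle**: for `h` equal to the identity off its last row, `γ(x) h = γ(x ᵥ* h)`.
[folklore] -/
theorem lastRowSection_mul_of_rows_eq (x : Fin (d + 1) → R) (h : Matrix (Fin (d + 1)) (Fin (d + 1)) R)
    (hh : ∀ i, i ≠ Fin.last d → ∀ j, h i j = (1 : Matrix (Fin (d + 1)) (Fin (d + 1)) R) i j) :
    lastRowSection x * h = lastRowSection (x ᵥ* h) := by
  ext i j
  by_cases hi : i = Fin.last d
  · subst hi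
    rw [lastRowSection_apply_last, Matrix.mul_apply, Matrix.vecMul, dotProduct]
    simp only [lastRowSection_apply_last]
  · rw [lastRowSection_apply_of_ne _ hi, Matrix.mul_apply]
    simp only [lastRowSection_apply_of_ne _ hi, Matrix.one_apply, ite_mul, one_mul, zero_mul,
      Finset.sum_ite_eq, Finset.mem_univ, if_true]
    rw [hh i hi j, Matrix.one_apply]

/-! ### The last-row group and the stabiliser -/

variable (d R) in
/-- **The last-row group** `H' = {h ∈ GL_{d+1}(R) | h = 𝟙 off the last row} = {(𝟙 0; y t)}`.
[folklore] -/
def lastRowGroup : Subgroup (GL (Fin (d + 1)) R) where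
  carrier := {h | ∀ i, i ≠ Fin.last d → ∀ j, h.val i j = (1 : Matrix (Fin (d + 1)) (Fin (d + 1)) R) i j}
  mul_mem' := by
    intro h h' hh hh' i hi j
    change (h.val * h'.val) i j = _
    rw [Matrix.mul_apply]
    simp only [hh i hi, Matrix.one_apply, ite_mul, one_mul, zero_mul, Finset.sum_ite_eq,
      Finset.mem_univ, if_true]
    rw [hh' i hi j, Matrix.one_apply]
  one_mem' := fun i _ j => rfl
  inv_mem' := by
    intro h hh i hi j
    -- row `i` of `h⁻¹` equals row `i` of `h h⁻¹ = 1`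
    have key : ∀ j, (h.val * (h⁻¹).val) i j = (h⁻¹).val i j := by
      intro j
      rw [Matrix.mul_apply]
      simp only [hh i hi, Matrix.one_apply, ite_mul, one_mul, zero_mul, Finset.sum_ite_eq,
        Finset.mem_univ, if_true]
    rw [← key j, ← Units.val_mul, mul_inv_cancel, Units.val_one]

/-- Membership in the last-row group. [folklore] -/
theorem mem_lastRowGroup_iff' {h : GL (Fin (d + 1)) R} :
    h ∈ lastRowGroup R d ↔ ∀ i, i ≠ Fin.last d → ∀ j,
      h.val i j = (1 : Matrix (Fin (d + 1)) (Fin (d + 1)) R) i j := Iff.rfl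

variable (d R) in
/-- **The stabiliser of the last row vector** (the mirabolic subgroup over a ring): the `p` with
`e ᵥ* p = e`, i.e. with last row `(0, …, 0, 1)`. [folklore] -/
def rowStabilizer : Subgroup (GL (Fin (d + 1)) R) where
  carrier := {p | lastBasisRow R d ᵥ* p.val = lastBasisRow R d}
  mul_mem' := by
    intro p q hp hq
    change lastBasisRow R d ᵥ* (p.val * q.val) = lastBasisRow R d
    rw [← Matrix.vecMul_vecMul, hp, hq]
  one_mem' := by
    change lastBasisRow R d ᵥ* (1 : Matrix (Fin (d + 1)) (Fin (d + 1)) R) = lastBasisRow R d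
    rw [Matrix.vecMul_one]
  inv_mem' := by
    intro p hp
    change lastBasisRow R d ᵥ* (p⁻¹).val = lastBasisRow R d
    conv_lhs => rw [← hp]
    rw [Matrix.vecMul_vecMul, ← Units.val_mul, mul_inv_cancel, Units.val_one, Matrix.vecMul_one]

/-- Membership in the stabiliser: `e ᵥ* p = e`. [folklore] -/
theorem mem_rowStabilizer_iff {p : GL (Fin (d + 1)) R} :
    p ∈ rowStabilizer R d ↔ lastBasisRow R d ᵥ* p.val = lastBasisRow R d := Iff.rfl

/-- Membership in the stabiliser, row form: the last row of `p` is `(0, …, 0, 1)`. [folklore] -/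
theorem mem_rowStabilizer_iff_row {p : GL (Fin (d + 1)) R} :
    p ∈ rowStabilizer R d ↔ ∀ j, p.val (Fin.last d) j = (1 : Matrix (Fin (d + 1)) (Fin (d + 1)) R) (Fin.last d) j := by
  rw [mem_rowStabilizer_iff, funext_iff]
  refine forall_congr' fun j => ?_
  rw [lastBasisRow, Matrix.single_one_vecMul]
  change p.val (Fin.last d) j = (Pi.single (Fin.last d) (1 : R) : Fin (d + 1) → R) j ↔
    p.val (Fin.last d) j = (1 : Matrix (Fin (d + 1)) (Fin (d + 1)) R) (Fin.last d) j
  by_cases hj : j = Fin.last d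
  · subst hj; simp
  · rw [Pi.single_eq_of_ne hj, Matrix.one_apply_ne (Ne.symm hj)]

/-! ### The section in `GL` and simple transitivity -/

/-- The section as an element of `GL_{d+1}(R)` when `x_{last}` is a unit. [folklore] -/
noncomputable def lastRowSectionGL (x : Fin (d + 1) → R) (hx : IsUnit (x (Fin.last d))) :
    GL (Fin (d + 1)) R :=
  Matrix.GeneralLinearGroup.mk'' (lastRowSection x) (by rwa [det_lastRowSection])

/-- The underlying matrix of `lastRowSectionGL`. [folklore] -/
@[simp] theorem val_lastRowSectionGL (x : Fin (d + 1) → R) (hx : IsUnit (x (Fin.last d))) :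
    (lastRowSectionGL x hx).val = lastRowSection x := rfl

/-- The sections lie in the last-row group. [folklore] -/
theorem lastRowSectionGL_mem (x : Fin (d + 1) → R) (hx : IsUnit (x (Fin.last d))) :
    lastRowSectionGL x hx ∈ lastRowGroup R d := fun i hi j => by
  rw [val_lastRowSectionGL, lastRowSection_apply_of_ne x hi]

/-- For `h` in the last-row group, the last coordinate of its last row is a unit (it is `det h`).
[folklore] -/
theorem isUnit_apply_last_of_mem {h : GL (Fin (d + 1)) R} (hh : h ∈ lastRowGroup R d) :
    IsUnit (h.val (Fin.last d) (Fin.last d)) := by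
  have hsec : lastRowSection (fun j => h.val (Fin.last d) j) = h.val := by
    ext i j
    by_cases hi : i = Fin.last d
    · subst hi; rw [lastRowSection_apply_last]
    · rw [lastRowSection_apply_of_ne _ hi, hh i hi j]
  have hdet := det_lastRowSection (fun j => h.val (Fin.last d) j)
  rw [hsec] at hdet
  rw [← hdet]
  exact (Matrix.isUnits_det_units h)

/-- **The last-row group consists exactly of the sections**: `h ∈ H'` iff `h = γ(e ᵥ* h)` with
`(e ᵥ* h)_{last}` a unit — so `H'` acts simply transitively on the chart `{x | x_{last} ∈ Rˣ}` by
`x ↦ x ᵥ* h`. [folklore] -/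
theorem mem_lastRowGroup_iff {h : GL (Fin (d + 1)) R} :
    h ∈ lastRowGroup R d ↔ ∃ (x : Fin (d + 1) → R) (hx : IsUnit (x (Fin.last d))),
      h = lastRowSectionGL x hx := by
  constructor
  · intro hh
    refine ⟨fun j => h.val (Fin.last d) j, isUnit_apply_last_of_mem hh, Units.ext ?_⟩
    rw [val_lastRowSectionGL]
    ext i j
    by_cases hi : i = Fin.last d
    · subst hi; rw [lastRowSection_apply_last]
    · rw [lastRowSection_apply_of_ne _ hi, hh i hi j]
  · rintro ⟨x, hx, rfl⟩
    exact lastRowSectionGL_mem x hx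

/-- The last row of a section: `e ᵥ* γ(x) = x` (in `GL`). [folklore] -/
theorem lastVec_vecMul_lastRowSectionGL (x : Fin (d + 1) → R) (hx : IsUnit (x (Fin.last d))) :
    lastBasisRow R d ᵥ* (lastRowSectionGL x hx).val = x := by
  rw [val_lastRowSectionGL, lastVec_vecMul_lastRowSection]

/-- **Trivial cocycle in `GL`**: `γ(x) h = γ(x ᵥ* h)` for `h` in the last-row group (both sides
have the same underlying matrix). [folklore] -/
theorem lastRowSectionGL_mul_of_mem (x : Fin (d + 1) → R) (hx : IsUnit (x (Fin.last d)))
    {h : GL (Fin (d + 1)) R} (hh : h ∈ lastRowGroup R d)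
    (hxh : IsUnit ((x ᵥ* h.val) (Fin.last d))) :
    lastRowSectionGL x hx * h = lastRowSectionGL (x ᵥ* h.val) hxh := by
  refine Units.ext ?_
  rw [Units.val_mul, val_lastRowSectionGL, val_lastRowSectionGL]
  exact lastRowSection_mul_of_rows_eq x h.val hh

/-- The unit condition needed in `lastRowSectionGL_mul_of_mem` holds automatically: the last
coordinate of `x ᵥ* h` is `x_{last} · h_{last,last}`, a product of units. [folklore] -/
theorem isUnit_vecMul_last_of_mem {x : Fin (d + 1) → R} (hx : IsUnit (x (Fin.last d)))
    {h : GL (Fin (d + 1)) R} (hh : h ∈ lastRowGroup R d) :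
    IsUnit ((x ᵥ* h.val) (Fin.last d)) := by
  have hcol : ∀ i, i ≠ Fin.last d → h.val i (Fin.last d) = 0 := fun i hi => by
    rw [hh i hi, Matrix.one_apply_ne hi]
  have : (x ᵥ* h.val) (Fin.last d) = x (Fin.last d) * h.val (Fin.last d) (Fin.last d) := by
    rw [Matrix.vecMul, dotProduct, Fintype.sum_eq_single (Fin.last d)]
    intro i hi
    rw [hcol i hi, mul_zero]
  rw [this]
  exact hx.mul (isUnit_apply_last_of_mem hh)

/-! ### The cocycle of the section under the stabiliser -/

/-- **The cocycle** `c(x, p) = γ(x) p γ(x ᵥ* p)⁻¹` of the section under right multiplication by a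
general `p` (defined when `x` and `x ᵥ* p` lie in the chart). [folklore] -/
noncomputable def chartCocycle (x : Fin (d + 1) → R) (hx : IsUnit (x (Fin.last d)))
    (p : GL (Fin (d + 1)) R) (hxp : IsUnit ((x ᵥ* p.val) (Fin.last d))) : GL (Fin (d + 1)) R :=
  lastRowSectionGL x hx * p * (lastRowSectionGL (x ᵥ* p.val) hxp)⁻¹

/-- Defining identity of the cocycle: `γ(x) p = c(x, p) γ(x ᵥ* p)`. [folklore] -/
theorem lastRowSectionGL_mul_eq_chartCocycle_mul (x : Fin (d + 1) → R) (hx : IsUnit (x (Fin.last d)))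
    (p : GL (Fin (d + 1)) R) (hxp : IsUnit ((x ᵥ* p.val) (Fin.last d))) :
    lastRowSectionGL x hx * p = chartCocycle x hx p hxp * lastRowSectionGL (x ᵥ* p.val) hxp := by
  rw [chartCocycle, inv_mul_cancel_right]

/-- **The cocycle takes values in the stabiliser** of the last row vector. [folklore] -/
theorem chartCocycle_mem_rowStabilizer (x : Fin (d + 1) → R) (hx : IsUnit (x (Fin.last d)))
    (p : GL (Fin (d + 1)) R) (hxp : IsUnit ((x ᵥ* p.val) (Fin.last d))) :
    chartCocycle x hx p hxp ∈ rowStabilizer R d := by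
  rw [mem_rowStabilizer_iff, chartCocycle]
  set γ' := lastRowSectionGL (x ᵥ* p.val) hxp with hγ'
  have h1 : lastBasisRow R d ᵥ* (lastRowSectionGL x hx * p).val = x ᵥ* p.val := by
    rw [Units.val_mul, ← Matrix.vecMul_vecMul, lastVec_vecMul_lastRowSectionGL]
  have h2 : lastBasisRow R d ᵥ* γ'.val = x ᵥ* p.val := lastVec_vecMul_lastRowSectionGL _ _
  rw [Units.val_mul, ← Matrix.vecMul_vecMul, h1, ← h2, Matrix.vecMul_vecMul, ← Units.val_mul,
    mul_inv_cancel, Units.val_one, Matrix.vecMul_one]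

/-- **At the base point the cocycle is `p` itself**: for `p` in the stabiliser,
`c(e, p) = p` (`γ(e) = 1`, `e ᵥ* p = e`). [folklore] -/
theorem chartCocycle_lastVec {p : GL (Fin (d + 1)) R} (hp : p ∈ rowStabilizer R d)
    (he : IsUnit (lastBasisRow R d (Fin.last d))) (hep : IsUnit ((lastBasisRow R d ᵥ* p.val) (Fin.last d))) :
    chartCocycle (lastBasisRow R d) he p hep = p := by
  have hγe : lastRowSectionGL (lastBasisRow R d) he = 1 := Units.ext (by
    rw [val_lastRowSectionGL, lastRowSection_lastVec, Units.val_one])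
  have hγep : lastRowSectionGL (lastBasisRow R d ᵥ* p.val) hep = 1 := Units.ext (by
    rw [val_lastRowSectionGL, Units.val_one]
    rw [mem_rowStabilizer_iff] at hp
    simp only [hp, lastRowSection_lastVec])
  rw [chartCocycle, hγe, hγep, one_mul, inv_one, mul_one]

/-- The base point lies in the chart: `e_{last} = 1` is a unit. [folklore] -/
theorem isUnit_lastVec_last : IsUnit (lastBasisRow R d (Fin.last d)) := by
  rw [lastBasisRow, Pi.single_eq_same]
  exact isUnit_one

end Literature.LinearAlgebra.Matrix
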